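import Summits.QuantumFields.BalabanUV.T4Continuum.Support.B13Represents
import Summits.QuantumFields.BalabanUV.T4Continuum.Support.B13TermRep

/-!
# NE5 ∕ U3 — row O1-d3 CLOSED ON THE MODEL OF RECORD: `TermRep` and the per-domain class bound for the ASSEMBLED step model
# `B13Represents.Assembly.step` (row O1-e, leaf-09, p208313) in every majorant currency of `B13TermRep` (leaf-04, p208307)

Cell `pub-balaban`, unit `b2b-balaban-t4-ne5-formalise-leaf-04` (NE5 formalisation swarm, LEAF PROVER 04; claim table
`t4/b2b-balaban-t4-ne5-p1/O1-CLAIM-TABLE-NE5-P1.md` row O1-d, part d3).  Summits-side new work under the LEAN PLACEMENT RULE (cell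
bookkeeping; NOT a Literature module).  HONEST FRAMING: rung (B)+1 of the FINITE-VOLUME T⁴ continuum programme — NOT infinite volume,
NOT a mass gap, NOT the Clay problem, NOT a proof of NE5 (NOT PRINTED in [Balaban1987RG1]–[Balaban1989LargeFieldII]; they print
ε-UNIFORM bounds, never η-RATES).  HONEST DEPENDENCY (cell line, verbatim): continuum YM on T⁴ ⇐ BetaPertH ∧ nine spine estimates
(0/9 proved); BetaPertH ⇐ (D1) ∧ (D4) ∧ CAP+tail; G-an2-4 gates asym, D1 and NE2/3/4.

WHAT THIS FILE DOES.  Row O1-e's model of record is `𝔄.step BHist : StepModel C (OpDatum E) Hist` for an assembly record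
`𝔄 : B13Represents.Assembly C E IOp Hist ι P J` (rows O1-a∕b∕c∕d plugged in), whose output field IS `B13StepTermFamily.out 𝔄.𝒯 𝔄.inc
𝔄.act` (`Assembly.step_Out`, `rfl`); leaf-09 recorded d3 there in the X-blind currency (`Assembly.termRep`, via
`TermRepOfSeries.termRep_of_out_eq_seriesOut`).  This leaf module (two imports, no cycle possible) records the remaining currencies
of `B13TermRep` for THAT model, each a one-line specialisation with `hM := rfl`:
* `termRep_step_of_boundAt` — X-DEPENDENT displayed majorant with per-domain summable weights (row O1-d1's finding, journal
  l.5621: with absolute term labels only the per-domain form is volume-uniform);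
* `termRep_step_of_actBound` — the SPLIT: an ACTIVITY majorant on the factors of the localizing tuples (the SHAPE of
  [Balaban1988RG2Cluster] Lemma 3 (2.38) p. 20, displayed, locator only) × the summability of the induced combinatorial majorant
  `B13TermRep.actMajorant` (the convergence of the Ursell series, p. 20 *"see [26, 67, 25, 50]"*, displayed);
* `classBound_step_of_actBound` — `ClassBound (𝔄.step BHist) K W κ G` from the activity majorant and the PER-DOMAIN budget
  `∑' i, actMajorant … k X i ≤ G·e^{−κd(X)}` (the per-X form of (2.41) p. 21, displayed).
Nothing is asserted about Bałaban's objects; no estimate is proved; 0 sorry; no new axioms.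
-/

noncomputable section

namespace Summit.QuantumFields.BalabanUV.T4Continuum.B13AssemblyTermRep

open Literature.MathematicalPhysics.QuantumFieldTheory.Balaban1983to89.T4OutputRate (Carriers)
open Literature.MathematicalPhysics.QuantumFieldTheory.Balaban1983to89.T4InputCauchyRateSpecies (ClassBound)
open Literature.MathematicalPhysics.QuantumFieldTheory.Balaban1983to89.T4InputCauchyRateTermwise (TermRep)
open Summit.QuantumFields.BalabanUV.T4Continuum.B13OpDatum (OpDatum)
open Summit.QuantumFields.BalabanUV.T4Continuum.B13StepTermFamily (term)
open Summit.QuantumFields.BalabanUV.T4Continuum.B13Represents (Assembly)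
open Summit.QuantumFields.BalabanUV.T4Continuum.B13TermRep
  (actMajorant termRep_b13_of_boundAt termRep_b13_of_actBound classBound_b13_of_actBound)

variable {C : Carriers} {E IOp Hist ι P J : Type*} [NormedAddCommGroup Hist] [NormedSpace ℂ Hist]
  (𝔄 : Assembly C E IOp Hist ι P J) (BHist : ℕ → ℝ)

/-- [folklore] **d3 for the model of record, X-DEPENDENT majorant**: a displayed majorant `‖term k i q.1 q.2 X‖ ≤ a k X i·e^{−κd(X)}`
on the class with `Summable (a k X)` at every step-`k` domain ⟹ `TermRep (𝔄.step BHist) K (term 𝔄.𝒯 𝔄.inc 𝔄.act) W`. -/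
theorem termRep_step_of_boundAt {K : ℕ → (ℕ → ℝ) → C.BgB → Set (OpDatum E × Hist)} {W : Set (ℕ → ℝ)} {κ : ℝ}
    {a : ℕ → C.Dom → ι → ℝ}
    (hbd : ∀ k, ∀ g ∈ W, ∀ (U : C.BgB) (q : OpDatum E × Hist), q ∈ K k g U → ∀ X : C.Dom, C.scale X = k →
      ∀ i, ‖term 𝔄.𝒯 𝔄.inc 𝔄.act k i q.1 q.2 X‖ ≤ a k X i * Real.exp (-(κ * C.d X)))
    (ha : ∀ (k : ℕ) (X : C.Dom), C.scale X = k → Summable (a k X)) :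
    TermRep (𝔄.step BHist) K (term 𝔄.𝒯 𝔄.inc 𝔄.act) W :=
  termRep_b13_of_boundAt 𝔄.𝒯 𝔄.inc 𝔄.act (fun _ _ _ _ => rfl) hbd ha

/-- [folklore] **d3 for the model of record from the SPLIT binders**: an activity majorant `A k g U` on the factors of the tuples
localizing at step-`k` domains, at every class point, and the summability of `actMajorant 𝔄.𝒯 𝔄.inc (A k g U) k X` at every
step-`k` domain ⟹ `TermRep (𝔄.step BHist) K (term 𝔄.𝒯 𝔄.inc 𝔄.act) W`. -/
theorem termRep_step_of_actBound {K : ℕ → (ℕ → ℝ) → C.BgB → Set (OpDatum E × Hist)} {W : Set (ℕ → ℝ)}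
    {A : ℕ → (ℕ → ℝ) → C.BgB → P → J → ℝ}
    (hA : ∀ k, ∀ g ∈ W, ∀ (U : C.BgB) (q : OpDatum E × Hist), q ∈ K k g U → ∀ X : C.Dom, C.scale X = k →
      ∀ i, 𝔄.𝒯.Rel k i X → ∀ m, ‖𝔄.act (𝔄.𝒯.poly i m) (𝔄.𝒯.lab i m) q.1 q.2‖ ≤ A k g U (𝔄.𝒯.poly i m) (𝔄.𝒯.lab i m))
    (hconv : ∀ k, ∀ g ∈ W, ∀ (U : C.BgB) (X : C.Dom), C.scale X = k →
      Summable (actMajorant 𝔄.𝒯 𝔄.inc (A k g U) k X)) :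
    TermRep (𝔄.step BHist) K (term 𝔄.𝒯 𝔄.inc 𝔄.act) W :=
  termRep_b13_of_actBound 𝔄.𝒯 𝔄.inc 𝔄.act (fun _ _ _ _ => rfl) hA hconv

/-- [folklore] **The per-domain class bound for the model of record from the SPLIT binders**: the activity majorant and the
per-domain budget `Summable (actMajorant … k X) ∧ ∑' i, actMajorant … k X i ≤ G·e^{−κd(X)}` ⟹ `ClassBound (𝔄.step BHist) K W κ G`. -/
theorem classBound_step_of_actBound {K : ℕ → (ℕ → ℝ) → C.BgB → Set (OpDatum E × Hist)} {W : Set (ℕ → ℝ)}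
    {A : ℕ → (ℕ → ℝ) → C.BgB → P → J → ℝ} {κ G : ℝ}
    (hA : ∀ k, ∀ g ∈ W, ∀ (U : C.BgB) (q : OpDatum E × Hist), q ∈ K k g U → ∀ X : C.Dom, C.scale X = k →
      ∀ i, 𝔄.𝒯.Rel k i X → ∀ m, ‖𝔄.act (𝔄.𝒯.poly i m) (𝔄.𝒯.lab i m) q.1 q.2‖ ≤ A k g U (𝔄.𝒯.poly i m) (𝔄.𝒯.lab i m))
    (hbud : ∀ k, ∀ g ∈ W, ∀ (U : C.BgB) (X : C.Dom), C.scale X = k →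
      Summable (actMajorant 𝔄.𝒯 𝔄.inc (A k g U) k X) ∧
        ∑' i, actMajorant 𝔄.𝒯 𝔄.inc (A k g U) k X i ≤ G * Real.exp (-(κ * C.d X))) :
    ClassBound (𝔄.step BHist) K W κ G :=
  classBound_b13_of_actBound (M := 𝔄.step BHist) (fun _ _ _ _ => rfl) hA hbud

end Summit.QuantumFields.BalabanUV.T4Continuum.B13AssemblyTermRep

end
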